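import Mathlib
import HarnessLib
import Literature.Probability.MarkovChains.MengersenTweedie
import Summits.Ventures.LatticeQCDFlow.Scoring.IMHGreenKubo

/-!
# The autocorrelation envelope of the exact flow-MCMC (IMH) chain: `|ρ_t| ≤ (1 − 1/w⋆)ᵗ` for every
# observable, `τ_int ≤ w⋆ − 1/2`, with equality for the indicator of the heaviest state

HONEST FRAMING: exact (Metropolis-corrected) sampling algorithms for lattice gauge theory;
figures of merit are autocorrelation/cost numbers at stated couplings and volumes; no
continuum-physics claim.

Venture `LatticeQCDFlow` (cell pub-lqcd), topic `Scoring`; FANOUT row 8 (`s0-cpn-nemc`, GEN-9).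
NEW WORK of the cell (elementary finite sums and one Cauchy–Schwarz), not a published result; the
published inputs are the Literature statements of Mengersen–Tweedie 1996 (`imh_minorized`: the IMH
kernel dominates `p/W` row by row when `p ≤ W · q`) and Wang 2022 Remark 1 (`imh_lawAt_single_mode`:
the exact law of the chain started at the mode of `w = p/q`), imported, not restated.  It is the
quantitative content of Liu's eigen-analysis of the independence sampler (every autocorrelation is
a positive mixture of geometric sequences with ratios `≤ 1 − a(w⋆) = 1 − 1/w⋆`; Liu 1996 Thm 2.1,
quoted as (T1) in the flow seat's `IMH-LAW-flow.md`) WITHOUT the spectral theorem: only the envelope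
and its sharpness are typed, which is what every `τ` statement uses.

## Content

GENERIC (any kernel `K` on a finite space with invariant probability vector `p ≥ 0` and the
whole-space Doeblin minorisation BY ITS OWN STATIONARY LAW, `K x y ≥ ε · p y`):
* `mv_pow_eq_residual_pow` — on CENTRED vectors (`pᵀ c = 0`) the chain acts through the residual
  `R = K − ε 𝟙 pᵀ` alone: `Kᵗ c = Rᵗ c` (the rank-one part annihilates centred vectors at every
  intermediate time because `p` is `R`-invariant up to the factor `1 − ε`);
* `residual_pow_nonneg / _row_sum / _stationary` — `Rᵗ ≥ 0`, row sums `(1 − ε)ᵗ`,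
  `pᵀ Rᵗ = (1 − ε)ᵗ pᵀ`;
* **`twoTime_abs_le_of_minorized`** — `|S_t(c, c)| ≤ (1 − ε)ᵗ · S_0(c, c)` with CONSTANT ONE (two
  Cauchy–Schwarz steps against the nonnegative weights `Rᵗ(x, ·)` and `p`), hence
  `abs_acf_le_of_minorized`: `|ρ_t| ≤ (1 − ε)ᵗ` and **`tauInt_le_of_minorized`**:
  `τ_int ≤ 1/ε − 1/2` for every centred observable (no reversibility used).
IMH (`K = imhMatrix p q`, `p ≤ W · q`, `ε = 1/W` by `imh_minorized`):
* **`imh_abs_acf_le`**: `|ρ_t(f)| ≤ (1 − 1/W)ᵗ` and **`imh_tauInt_le`**: `τ_int(f) ≤ W − 1/2` for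
  EVERY observable `f` of the exact flow-MCMC chain; in sector vocabulary `acfA_le_pow`,
  `tauInt_acfA_le` (the upper companions of the tree's sticking-floor LOWER bounds
  `Scoring.acfA_lower`, `stickingFloor_le_tauInt_exact`);
* **SHARPNESS** (`acfA_mode_eq`, **`tauInt_acfA_mode_eq`**): if the bound is attained at a state
  `x⋆` (`p x⋆ = W q x⋆`, `p x⋆ < 1`) then the indicator of `x⋆` has EXACTLY geometric
  autocorrelation `ρ_t = (1 − 1/W)ᵗ` and `τ_int(1_{x⋆}) = W − 1/2`.
So for the exact flow-MCMC chain with normalised target and model, `sup_f τ_int(f) = w⋆ − 1/2`,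
`w⋆ = max p/q`: the worst integrated autocorrelation time IS the weight bound, to the constant.
-/

namespace Summit.Ventures.LatticeQCDFlow.Scoring

open Finset Literature.Probability.MarkovChains Summit.Ventures.LatticeQCDFlow.Exactness

variable {X : Type*} [Fintype X] [DecidableEq X]

/-! ### Generic: a kernel minorised by its own stationary law acts on centred vectors through the
residual -/

section Generic

variable {K R : Matrix X X ℝ} {p : X → ℝ} {ε r : ℝ}

omit [DecidableEq X] in
/-- A `p`-stationary kernel maps centred vectors to centred vectors: `pᵀ(K c) = pᵀ c = 0`. -/
theorem sum_mul_mv_eq_zero_of_stationary (hstat : ∀ y, ∑ x, p x * K x y = p y) {c : X → ℝ}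
    (hc : ∑ x, p x * c x = 0) : ∑ x, p x * mv K c x = 0 := by
  calc ∑ x, p x * mv K c x = ∑ x, ∑ y, p x * K x y * c y := by
        refine sum_congr rfl fun x _ => ?_
        rw [mv, mul_sum]
        exact sum_congr rfl fun y _ => by ring
    _ = ∑ y, ∑ x, p x * K x y * c y := sum_comm
    _ = ∑ y, p y * c y := by
        refine sum_congr rfl fun y _ => ?_
        rw [← sum_mul, hstat y]
    _ = 0 := hc

omit [DecidableEq X] in
/-- On a centred vector the residual `R = K − ε 𝟙 pᵀ` acts as `K`: `R c = K c`. -/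
theorem mv_residual_eq_of_centred (hR : ∀ x y, R x y = K x y - ε * p y) {c : X → ℝ}
    (hc : ∑ x, p x * c x = 0) : mv R c = mv K c := by
  funext x
  have h : ∑ y, ε * p y * c y = 0 := by
    rw [show ∑ y, ε * p y * c y = ε * ∑ y, p y * c y by
      rw [mul_sum]; exact sum_congr rfl fun y _ => by ring, hc, mul_zero]
  simp only [mv, hR, sub_mul, sum_sub_distrib, h, sub_zero]

/-- **Centred vectors evolve through the residual alone**: `Kᵗ c = Rᵗ c` for `pᵀ c = 0`
(`p` stationary for `K`, `R = K − ε 𝟙 pᵀ`). -/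
theorem mv_pow_eq_residual_pow (hstat : ∀ y, ∑ x, p x * K x y = p y)
    (hR : ∀ x y, R x y = K x y - ε * p y) :
    ∀ (t : ℕ) (c : X → ℝ), ∑ x, p x * c x = 0 → mv (K ^ t) c = mv (R ^ t) c := by
  intro t
  induction t with
  | zero => intro c _; simp
  | succ t ih =>
    intro c hc
    rw [pow_succ, pow_succ, mv_mul, mv_mul, ← mv_residual_eq_of_centred hR hc]
    refine ih (mv R c) ?_
    rw [mv_residual_eq_of_centred hR hc]
    exact sum_mul_mv_eq_zero_of_stationary hstat hc

/-- Powers of an entrywise nonnegative matrix are entrywise nonnegative. -/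
theorem residual_pow_nonneg (hR0 : ∀ x y, 0 ≤ R x y) : ∀ (t : ℕ) (x y : X), 0 ≤ (R ^ t) x y := by
  intro t
  induction t with
  | zero =>
    intro x y
    rw [pow_zero, Matrix.one_apply]
    split_ifs <;> norm_num
  | succ t ih =>
    intro x y
    rw [pow_succ, Matrix.mul_apply]
    exact sum_nonneg fun z _ => mul_nonneg (ih x z) (hR0 z y)

/-- Row sums of the powers: `Σ_y Rᵗ x y = rᵗ` when every row of `R` sums to `r`. -/
theorem residual_pow_row_sum (hrow : ∀ x, ∑ y, R x y = r) : ∀ (t : ℕ) (x : X),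
    ∑ y, (R ^ t) x y = r ^ t := by
  intro t
  induction t with
  | zero => intro x; simp [Matrix.one_apply]
  | succ t ih =>
    intro x
    calc ∑ y, (R ^ (t + 1)) x y = ∑ y, ∑ z, (R ^ t) x z * R z y := by
          refine sum_congr rfl fun y _ => ?_
          rw [pow_succ, Matrix.mul_apply]
      _ = ∑ z, (R ^ t) x z * ∑ y, R z y := by
          rw [sum_comm]
          exact sum_congr rfl fun z _ => by rw [mul_sum]
      _ = r ^ (t + 1) := by
          simp_rw [hrow, ← sum_mul, ih x]
          ring

/-- A scaled stationarity `pᵀ R = r pᵀ` propagates to the powers: `pᵀ Rᵗ = rᵗ pᵀ`. -/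
theorem residual_pow_stationary (hst : ∀ y, ∑ x, p x * R x y = r * p y) :
    ∀ (t : ℕ) (y : X), ∑ x, p x * (R ^ t) x y = r ^ t * p y := by
  intro t
  induction t with
  | zero =>
    intro y
    simp only [pow_zero, Matrix.one_apply, mul_ite, mul_one, mul_zero, one_mul]
    rw [sum_ite_eq' univ y]
    simp
  | succ t ih =>
    intro y
    calc ∑ x, p x * (R ^ (t + 1)) x y = ∑ x, ∑ z, p x * (R ^ t) x z * R z y := by
          refine sum_congr rfl fun x _ => ?_
          rw [pow_succ, Matrix.mul_apply, mul_sum]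
          exact sum_congr rfl fun z _ => by ring
      _ = ∑ z, (∑ x, p x * (R ^ t) x z) * R z y := by
          rw [sum_comm]
          exact sum_congr rfl fun z _ => by rw [sum_mul]
      _ = r ^ t * ∑ z, p z * R z y := by
          simp_rw [ih, mul_sum]
          exact sum_congr rfl fun z _ => by ring
      _ = r ^ (t + 1) * p y := by rw [hst y]; ring

omit [DecidableEq X] in
/-- Cauchy–Schwarz / Jensen against a nonnegative row: `(N g)(x)² ≤ (Σ_y N x y) · Σ_y N x y g y²`. -/
theorem sq_mv_le {N : Matrix X X ℝ} {x : X} (hN : ∀ y, 0 ≤ N x y) (g : X → ℝ) :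
    mv N g x ^ 2 ≤ (∑ y, N x y) * ∑ y, N x y * g y ^ 2 := by
  unfold mv
  exact sum_sq_le_sum_mul_sum_of_sq_le_mul univ (fun y _ => hN y)
    (fun y _ => mul_nonneg (hN y) (sq_nonneg _)) (fun y _ => le_of_eq (by ring))

omit [DecidableEq X] in
/-- Under a minorisation `K x y ≥ ε p y` of a row-stochastic kernel (`Σ p = 1`), `ε ≤ 1`. -/
theorem one_sub_nonneg_of_minorized (hp1 : ∑ x, p x = 1) (hrow : ∀ x, ∑ y, K x y = 1)
    (hmin : ∀ x y, ε * p y ≤ K x y) : 0 ≤ 1 - ε := by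
  obtain ⟨x0, -⟩ : (univ : Finset X).Nonempty :=
    nonempty_of_sum_ne_zero (by rw [hp1]; exact one_ne_zero)
  have h1 : ∑ y, (K x0 y - ε * p y) = 1 - ε := by
    simp only [sum_sub_distrib, ← mul_sum, hp1, hrow x0, mul_one]
  rw [← h1]
  exact sum_nonneg fun y _ => by linarith [hmin x0 y]

/-- **The autocorrelation envelope under a minorisation by the stationary law.**  If `p ≥ 0`,
`Σ p = 1`, `p` is stationary for the row-stochastic `K` and `K x y ≥ ε · p y` for all `x, y`, then
for every centred `c`: `|S_t(c, c)| ≤ (1 − ε)ᵗ · S_0(c, c)` — constant one, no reversibility. -/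
theorem twoTime_abs_le_of_minorized (hp0 : ∀ x, 0 ≤ p x) (hp1 : ∑ x, p x = 1)
    (hrow : ∀ x, ∑ y, K x y = 1) (hstat : ∀ y, ∑ x, p x * K x y = p y)
    (hmin : ∀ x y, ε * p y ≤ K x y) {c : X → ℝ} (hc : ∑ x, p x * c x = 0) (t : ℕ) :
    |twoTime p K t c c| ≤ (1 - ε) ^ t * twoTime p K 0 c c := by
  -- the residual and its bookkeeping
  set R : Matrix X X ℝ := Matrix.of fun x y => K x y - ε * p y with hRdef
  have hR : ∀ x y, R x y = K x y - ε * p y := fun x y => by rw [hRdef, Matrix.of_apply]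
  have hR0 : ∀ x y, 0 ≤ R x y := fun x y => by rw [hR]; linarith [hmin x y]
  have hRrow : ∀ x, ∑ y, R x y = 1 - ε := fun x => by
    simp only [hR, sum_sub_distrib, ← mul_sum, hp1, hrow x, mul_one]
  have hRst : ∀ y, ∑ x, p x * R x y = (1 - ε) * p y := fun y => by
    simp only [hR, mul_sub, sum_sub_distrib, hstat y]
    rw [show ∑ x, p x * (ε * p y) = (∑ x, p x) * (ε * p y) by rw [sum_mul], hp1]
    ring
  have hl0 : 0 ≤ 1 - ε := one_sub_nonneg_of_minorized hp1 hrow hmin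
  -- S_t(c,c) = Σ p c (Rᵗ c)
  set u : X → ℝ := mv (R ^ t) c with hu
  have hSt : twoTime p K t c c = ∑ x, p x * c x * u x := by
    unfold twoTime
    rw [mv_pow_eq_residual_pow hstat hR t c hc]
  have hS0 : twoTime p K 0 c c = ∑ x, p x * c x ^ 2 := by
    rw [twoTime_zero]; exact sum_congr rfl fun x _ => by ring
  have hS0nn : 0 ≤ ∑ x, p x * c x ^ 2 := sum_nonneg fun x _ => mul_nonneg (hp0 x) (sq_nonneg _)
  -- Σ p u² ≤ (1-ε)^{2t} Σ p c²
  have hu2 : ∑ x, p x * u x ^ 2 ≤ ((1 - ε) ^ t) ^ 2 * ∑ x, p x * c x ^ 2 := by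
    calc ∑ x, p x * u x ^ 2 ≤ ∑ x, p x * ((1 - ε) ^ t * ∑ y, (R ^ t) x y * c y ^ 2) := by
          refine sum_le_sum fun x _ => mul_le_mul_of_nonneg_left ?_ (hp0 x)
          have h := sq_mv_le (residual_pow_nonneg hR0 t x) c
          rwa [residual_pow_row_sum hRrow t x] at h
      _ = (1 - ε) ^ t * ∑ y, (∑ x, p x * (R ^ t) x y) * c y ^ 2 := by
          rw [mul_sum]
          simp_rw [sum_mul, mul_sum]
          rw [sum_comm]
          exact sum_congr rfl fun y _ => sum_congr rfl fun x _ => by ring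
      _ = ((1 - ε) ^ t) ^ 2 * ∑ x, p x * c x ^ 2 := by
          simp_rw [residual_pow_stationary hRst t, mul_sum]
          exact sum_congr rfl fun y _ => by ring
  -- Cauchy–Schwarz: (Σ p c u)² ≤ (Σ p c²)(Σ p u²)
  have hCS : (∑ x, p x * c x * u x) ^ 2 ≤ (∑ x, p x * c x ^ 2) * ∑ x, p x * u x ^ 2 :=
    sum_sq_le_sum_mul_sum_of_sq_le_mul univ (fun x _ => mul_nonneg (hp0 x) (sq_nonneg _))
      (fun x _ => mul_nonneg (hp0 x) (sq_nonneg _)) (fun x _ => le_of_eq (by ring))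
  rw [hSt, hS0]
  refine abs_le_of_sq_le_sq ?_ (mul_nonneg (pow_nonneg hl0 t) hS0nn)
  calc (∑ x, p x * c x * u x) ^ 2 ≤ (∑ x, p x * c x ^ 2) * ∑ x, p x * u x ^ 2 := hCS
    _ ≤ (∑ x, p x * c x ^ 2) * (((1 - ε) ^ t) ^ 2 * ∑ x, p x * c x ^ 2) :=
        mul_le_mul_of_nonneg_left hu2 hS0nn
    _ = ((1 - ε) ^ t * ∑ x, p x * c x ^ 2) ^ 2 := by ring

/-- Hence the normalised autocorrelation is inside the geometric envelope: `|ρ_t| ≤ (1 − ε)ᵗ`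
(`ρ_t = S_t(c, c)/S_0(c, c)`; for a degenerate `S_0 = 0` Lean's `x/0 = 0` makes it trivial). -/
theorem abs_acf_le_of_minorized (hp0 : ∀ x, 0 ≤ p x) (hp1 : ∑ x, p x = 1)
    (hrow : ∀ x, ∑ y, K x y = 1) (hstat : ∀ y, ∑ x, p x * K x y = p y)
    (hmin : ∀ x y, ε * p y ≤ K x y) {c : X → ℝ} (hc : ∑ x, p x * c x = 0) (t : ℕ) :
    |twoTime p K t c c / twoTime p K 0 c c| ≤ (1 - ε) ^ t := by
  have h := twoTime_abs_le_of_minorized hp0 hp1 hrow hstat hmin hc t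
  have h0 := twoTime_abs_le_of_minorized hp0 hp1 hrow hstat hmin hc 0
  rw [pow_zero, one_mul] at h0
  have hS0 : 0 ≤ twoTime p K 0 c c := (abs_nonneg _).trans h0
  rcases hS0.eq_or_lt with hz | hpos
  · rw [← hz, div_zero, abs_zero]
    exact pow_nonneg (one_sub_nonneg_of_minorized hp1 hrow hmin) t
  · rw [abs_div, abs_of_pos hpos, div_le_iff₀ hpos]
    exact h

/-- **`τ_int ≤ 1/ε − 1/2`** for every centred observable of a chain minorised by its stationary
law with constant `ε > 0` (on the tree's `tauInt`; the ACF is summable by the envelope). -/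
theorem tauInt_le_of_minorized (hp0 : ∀ x, 0 ≤ p x) (hp1 : ∑ x, p x = 1)
    (hrow : ∀ x, ∑ y, K x y = 1) (hstat : ∀ y, ∑ x, p x * K x y = p y)
    (hmin : ∀ x y, ε * p y ≤ K x y) (hε : 0 < ε) {c : X → ℝ} (hc : ∑ x, p x * c x = 0) :
    tauInt (fun t => twoTime p K t c c / twoTime p K 0 c c) ≤ 1 / ε - 1 / 2 := by
  have henv := fun t => abs_acf_le_of_minorized hp0 hp1 hrow hstat hmin hc t
  have hl0 : 0 ≤ 1 - ε := one_sub_nonneg_of_minorized hp1 hrow hmin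
  have hl1 : 1 - ε < 1 := by linarith
  have habs : |1 - ε| < 1 := by rw [abs_of_nonneg hl0]; exact hl1
  have hgeo := hasSum_geometric_succ habs
  have hsum : Summable fun t : ℕ => twoTime p K (t + 1) c c / twoTime p K 0 c c :=
    Summable.of_norm_bounded hgeo.summable fun t => by
      rw [Real.norm_eq_abs]; exact henv (t + 1)
  have hle : ∑' t : ℕ, twoTime p K (t + 1) c c / twoTime p K 0 c c ≤ (1 - ε) / (1 - (1 - ε)) :=
    by
    rw [← hgeo.tsum_eq]
    exact Summable.tsum_le_tsum (fun t => (le_abs_self _).trans (henv (t + 1))) hsum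
      hgeo.summable
  unfold tauInt
  have hε' : (1 - ε) / (1 - (1 - ε)) = 1 / ε - 1 := by
    rw [sub_sub_cancel, sub_div, div_self hε.ne']
  linarith [hle, hε']

end Generic

/-! ### The exact flow-MCMC chain: envelope `(1 − 1/W)ᵗ`, `τ_int ≤ W − 1/2` -/

/-- **`|ρ_t(f)| ≤ (1 − 1/W)ᵗ` for EVERY observable of the exact flow-MCMC chain** with
`p ≤ W · q` (`c` = the centred observable, `ρ_t = S_t(c, c)/S_0(c, c)`). -/
theorem imh_abs_acf_le {p q : X → ℝ} {W : ℝ} (hp : ∀ x, 0 < p x) (hp1 : ∑ x, p x = 1)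
    (hq : ∀ x, 0 ≤ q x) (hq1 : ∑ x, q x = 1) (hW : ∀ x, p x ≤ W * q x) {c : X → ℝ}
    (hc : ∑ x, p x * c x = 0) (t : ℕ) :
    |twoTime p (imhMatrix p q) t c c / twoTime p (imhMatrix p q) 0 c c| ≤ (1 - W⁻¹) ^ t :=
  abs_acf_le_of_minorized (fun x => (hp x).le) hp1 (imhKernel_isRowStochastic hp hq hq1).2
    (imhKernel_isStationary hp q) (fun x y => imh_minorized hp hq hq1 hW x y) hc t

/-- **`τ_int(f) ≤ W − 1/2` for EVERY observable of the exact flow-MCMC chain** with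
`p ≤ W · q`. -/
theorem imh_tauInt_le {p q : X → ℝ} {W : ℝ} (hp : ∀ x, 0 < p x) (hp1 : ∑ x, p x = 1)
    (hq : ∀ x, 0 ≤ q x) (hq1 : ∑ x, q x = 1) (hW : ∀ x, p x ≤ W * q x) {c : X → ℝ}
    (hc : ∑ x, p x * c x = 0) :
    tauInt (fun t => twoTime p (imhMatrix p q) t c c / twoTime p (imhMatrix p q) 0 c c)
      ≤ W - 1 / 2 := by
  have hW1 : 1 ≤ W := by
    have h : ∑ x, p x ≤ ∑ x, W * q x := sum_le_sum fun x _ => hW x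
    rwa [hp1, ← mul_sum, hq1, mul_one] at h
  have h := tauInt_le_of_minorized (fun x => (hp x).le) hp1
    (imhKernel_isRowStochastic hp hq hq1).2 (imhKernel_isStationary hp q)
    (fun x y => imh_minorized hp hq hq1 hW x y) (inv_pos.2 (one_pos.trans_le hW1)) hc
  rwa [one_div, inv_inv] at h

/-- Sector form, upper companion of `Scoring.acfA_lower`: `ρ_t(1_A) ≤ (1 − 1/W)ᵗ` for every
sector `A`. -/
theorem acfA_le_pow {p q : X → ℝ} {W : ℝ} (hp : ∀ x, 0 < p x) (hp1 : ∑ x, p x = 1)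
    (hq : ∀ x, 0 ≤ q x) (hq1 : ∑ x, q x = 1) (hW : ∀ x, p x ≤ W * q x) (A : Finset X)
    (t : ℕ) : acfA p q A t ≤ (1 - W⁻¹) ^ t := by
  unfold acfA
  rw [autocovA_eq_twoTime, autocovA_eq_twoTime]
  exact (le_abs_self _).trans
    (imh_abs_acf_le hp hp1 hq hq1 hW (sum_mul_centredIndicator_eq_zero hp1 A) t)

/-- Sector form, upper companion of `Scoring.stickingFloor_le_tauInt_exact`:
`τ_int(1_A) ≤ W − 1/2` for every sector `A`. -/
theorem tauInt_acfA_le {p q : X → ℝ} {W : ℝ} (hp : ∀ x, 0 < p x) (hp1 : ∑ x, p x = 1)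
    (hq : ∀ x, 0 ≤ q x) (hq1 : ∑ x, q x = 1) (hW : ∀ x, p x ≤ W * q x) (A : Finset X) :
    tauInt (acfA p q A) ≤ W - 1 / 2 := by
  have hfun : acfA p q A = fun t => twoTime p (imhMatrix p q) t
      (fun x => (if x ∈ A then 1 else 0) - mass p A) (fun x => (if x ∈ A then 1 else 0) - mass p A)
      / twoTime p (imhMatrix p q) 0
      (fun x => (if x ∈ A then 1 else 0) - mass p A)
      (fun x => (if x ∈ A then 1 else 0) - mass p A) := by
    funext t
    unfold acfA
    rw [autocovA_eq_twoTime, autocovA_eq_twoTime]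
  rw [hfun]
  exact imh_tauInt_le hp hp1 hq hq1 hW (sum_mul_centredIndicator_eq_zero hp1 A)

/-! ### Sharpness: the indicator of the heaviest state -/

/-- At a state `x⋆` where the weight bound is attained (`p x⋆ = W q x⋆`) the joint return
probability is Wang's: `P(X₀ = x⋆, X_t = x⋆) = p x⋆ · ((1 − 1/W)ᵗ + (1 − (1 − 1/W)ᵗ) p x⋆)`. -/
theorem jointA_mode_eq {p q : X → ℝ} {W : ℝ} (hp : ∀ x, 0 < p x) (hp1 : ∑ x, p x = 1)
    (hq : ∀ x, 0 ≤ q x) (hW : ∀ x, p x ≤ W * q x) {xs : X} (hxs : p xs = W * q xs) (t : ℕ) :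
    jointA p q {xs} t = p xs * ((1 - W⁻¹) ^ t + (1 - (1 - W⁻¹) ^ t) * p xs) := by
  unfold jointA
  rw [sum_singleton, sum_singleton]
  have h := congrFun (imh_lawAt_single_mode hp hp1 hq hW hxs t) xs
  rw [Pi.single_eq_same, mul_one] at h
  rw [show imhKernel p q = mhKernel (fun _ z => q z) p from rfl, h]

/-- … so the indicator of `x⋆` has autocovariance `C_t = p x⋆ (1 − p x⋆) (1 − 1/W)ᵗ`. -/
theorem autocovA_mode_eq {p q : X → ℝ} {W : ℝ} (hp : ∀ x, 0 < p x) (hp1 : ∑ x, p x = 1)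
    (hq : ∀ x, 0 ≤ q x) (hq1 : ∑ x, q x = 1) (hW : ∀ x, p x ≤ W * q x) {xs : X}
    (hxs : p xs = W * q xs) (t : ℕ) :
    autocovA p q {xs} t = p xs * (1 - p xs) * (1 - W⁻¹) ^ t := by
  rw [autocovA_eq hp hp1 hq hq1, jointA_mode_eq hp hp1 hq hW hxs]
  unfold mass
  rw [sum_singleton]
  ring

/-- **Sharpness of the envelope**: the indicator of the heaviest state has EXACTLY geometric
autocorrelation `ρ_t(1_{x⋆}) = (1 − 1/W)ᵗ` (`p x⋆ < 1`, i.e. the chain has more than one state of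
positive mass). -/
theorem acfA_mode_eq {p q : X → ℝ} {W : ℝ} (hp : ∀ x, 0 < p x) (hp1 : ∑ x, p x = 1)
    (hq : ∀ x, 0 ≤ q x) (hq1 : ∑ x, q x = 1) (hW : ∀ x, p x ≤ W * q x) {xs : X}
    (hxs : p xs = W * q xs) (hps : p xs < 1) (t : ℕ) : acfA p q {xs} t = (1 - W⁻¹) ^ t := by
  unfold acfA
  rw [autocovA_mode_eq hp hp1 hq hq1 hW hxs, autocovA_mode_eq hp hp1 hq hq1 hW hxs, pow_zero,
    mul_one]
  have h0 : p xs * (1 - p xs) ≠ 0 := mul_ne_zero (hp xs).ne' (by linarith)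
  exact mul_div_cancel_left₀ _ h0

/-- **`τ_int(1_{x⋆}) = W − 1/2` exactly**: the bound `imh_tauInt_le` is attained by the indicator
of the heaviest state, so `sup_f τ_int(f) = w⋆ − 1/2` for the exact flow-MCMC chain. -/
theorem tauInt_acfA_mode_eq {p q : X → ℝ} {W : ℝ} (hp : ∀ x, 0 < p x) (hp1 : ∑ x, p x = 1)
    (hq : ∀ x, 0 ≤ q x) (hq1 : ∑ x, q x = 1) (hW : ∀ x, p x ≤ W * q x) {xs : X}
    (hxs : p xs = W * q xs) (hps : p xs < 1) : tauInt (acfA p q {xs}) = W - 1 / 2 := by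
  obtain ⟨hr0, hr1⟩ := rate_nonneg_and_lt_one hp1 hq1 hW
  have hfun : acfA p q {xs} = fun t => (1 - W⁻¹) ^ t :=
    funext fun t => acfA_mode_eq hp hp1 hq hq1 hW hxs hps t
  have habs : |1 - W⁻¹| < 1 := by rw [abs_of_nonneg hr0]; exact hr1
  rw [hfun, tauInt_geometric habs]
  have hW0 : W ≠ 0 := by
    rintro rfl
    simp at hr1
  field_simp
  ring

end Summit.Ventures.LatticeQCDFlow.Scoring
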